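import Literature.MathematicalPhysics.QuantumLattice.HubbardLatticeActivity
import HarnessLib

/-!
# The Hubbard polymer activity: reality, holomorphy in `(β, μ)`, the admissible complex domain

The parameter dependence needed to run the cluster expansion of Ueltschi (1999), Thm 2.1 (i)
("`Φ^T(C)` is analytic in `β` and `μ` … by Vitali theorem"), for the intrinsic lattice
activity `latticeActivity` of `HubbardLatticeActivity`:

* **reality** (`conj_Zc`, …, `conj_latticeActivity`, `latticeActivity_im_eq_zero`): complex
  conjugation of the parameters conjugates the Gibbs factor, the bond weights and the
  activities (the Jordan–Wigner matrices are real, and `exp` commutes with the entrywise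
  conjugation ring homomorphism); at real `β, U, μ, τ` the activities are real;
* **holomorphy** (`differentiableOn_latticeActivity`): for fixed `U, t`, the map
  `(β, μ) ↦ latticeActivity d β U μ (βt) A` is complex-differentiable on `{z₀(β,U,μ) ≠ 0} ⊆ ℂ²`
  (the exponent `-βU Σ n↑n↓ + βμ N + βt T_K` is polynomial in `(β, μ)`, `exp` is entire on
  the matrix algebra, and the normalisation `Zc(0) = z₀^{|A|}` does not vanish there);
* **the admissible domain** (`admissibleSet U t`): `z₀ ≠ 0`, site ratio `< 2`, `|β| t < τ₀`;
  it is open (`isOpen_admissibleSet`), contains the real points `(β, μ)` with `0 ≤ β`,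
  `βt < τ₀` (`mem_admissibleSet_of_real`), and on it the lattice activity on `ℤ²` is a small
  translation-invariant activity depending holomorphically on `(β, μ)`; consequently the polymer
  pressure `(β, μ) ↦ p(ρ_{β,μ})` is analytic there (`analyticOnNhd_polymerPressure_lattice`, from
  `PolymerPressureAnalytic.analyticOnNhd_polymerPressure`).

Everything is PROVED.

## Mathlib / tree search

Tree: `latticeActivity`, `isSmallTIActivity_latticeActivity`, `tau0` (`HubbardLatticeActivity`),
`siteRatio`, `siteRatio_ofReal` (`HubbardPolymerBounds`), `Zc`, `Zc_zero`, `analyticOnNhd_polymerPressure`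
(`PolymerPressureAnalytic`), `creation_apply`, `annihilation_apply`. Mathlib: `RingHom.mapMatrix`,
`NormedSpace.map_exp`, `AddMonoidHom.map_trace`, `NormedSpace.exp_analytic`,
`ContinuousOn.isOpen_inter_preimage`.

## References

* D. Ueltschi, J. Stat. Phys. 95 (1999) 693, §2.3 (analyticity of the weights and of `Φ^T`),
  §3. [Ueltschi1999]
-/

noncomputable section

namespace Literature.MathematicalPhysics.QuantumLattice

open Matrix Finset HubbardWave0 Literature.Analysis.Complex.FiniteDifference Literature.Probability.LatticeModels
open scoped BigOperators ComplexConjugate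

/-! ### Reality: conjugation of the parameters -/

section Conj

variable {Λ : Type*} [LinearOrder Λ] [Fintype Λ]

/-- Entrywise complex conjugation of Fock-space matrices, as a ring homomorphism. [folklore] -/
abbrev conjMat : Matrix (Finset (Orb Λ)) (Finset (Orb Λ)) ℂ →+* Matrix (Finset (Orb Λ)) (Finset (Orb Λ)) ℂ :=
  RingHom.mapMatrix (starRingEnd ℂ)

/-- The Jordan–Wigner sign is real. [folklore] -/
theorem conj_jwSign {ι : Type*} [LinearOrder ι] (i : ι) (s : Finset ι) : conj (jwSign i s) = jwSign i s := by
  simp [jwSign]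

/-- The annihilation matrices are real. [folklore] -/
theorem conjMat_annihilation (i : Orb Λ) : conjMat (annihilation i) = annihilation i := by
  ext s t
  rw [RingHom.mapMatrix_apply, Matrix.map_apply, annihilation_apply]
  split_ifs <;> simp [conj_jwSign]

/-- The creation matrices are real. [folklore] -/
theorem conjMat_creation (i : Orb Λ) : conjMat (creation i) = creation i := by
  ext t s
  rw [RingHom.mapMatrix_apply, Matrix.map_apply, creation_apply]
  split_ifs <;> simp [conj_jwSign]

/-- Conjugation of a scalar multiple. [folklore] -/
theorem conjMat_smul (c : ℂ) (M : Matrix (Finset (Orb Λ)) (Finset (Orb Λ)) ℂ) : conjMat (c • M) = conj c • conjMat M := by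
  ext s t
  simp [Matrix.map_apply]

/-- `T_b` is real. [folklore] -/
theorem conjMat_bondOp (b : Bond Λ) : conjMat (bondOp b) = bondOp b := by
  rw [bondOp, map_mul, conjMat_creation, conjMat_annihilation]

/-- `n_{xσ}` is real. [folklore] -/
theorem conjMat_numberOp (x : Λ) (σ : Fin 2) : conjMat (numberOp x σ) = numberOp x σ := by
  rw [numberOp, map_mul, conjMat_creation, conjMat_annihilation]

/-- Conjugation of the on-site operator conjugates the parameters. [folklore] -/
theorem conjMat_onSiteSum (U μ : ℂ) (A : Finset Λ) : conjMat (onSiteSum U μ A) = onSiteSum (conj U) (conj μ) A := by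
  unfold onSiteSum onSiteOp
  rw [map_sum]
  refine Finset.sum_congr rfl fun x _ => ?_
  rw [map_sub, conjMat_smul, conjMat_smul, map_mul, map_add, conjMat_numberOp, conjMat_numberOp]

/-- Conjugation of the hopping operator conjugates the couplings. [folklore] -/
theorem conjMat_hopSum (c : Bond Λ → ℂ) : conjMat (hopSum c) = hopSum fun b => conj (c b) := by
  unfold hopSum
  rw [map_sum]
  exact Finset.sum_congr rfl fun b _ => by rw [conjMat_smul, conjMat_bondOp]

/-- Conjugation commutes with the matrix exponential. [folklore] -/
theorem conjMat_exp (X : Matrix (Finset (Orb Λ)) (Finset (Orb Λ)) ℂ) : conjMat (NormedSpace.exp X) = NormedSpace.exp (conjMat X) :=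
  open scoped Matrix.Norms.Operator in NormedSpace.map_exp _ (continuous_id.matrix_map Complex.continuous_conj) X

/-- Conjugation of a trace. [folklore] -/
theorem conj_trace (X : Matrix (Finset (Orb Λ)) (Finset (Orb Λ)) ℂ) : conj X.trace = (conjMat X).trace := by
  simp [Matrix.trace, map_sum, Matrix.map_apply]

/-- **The Gibbs factor at conjugate parameters is the conjugate Gibbs factor.** [folklore] -/
theorem conj_Zc (β U μ : ℂ) (c : Bond Λ → ℂ) : conj (Zc β U μ c) = Zc (conj β) (conj U) (conj μ) fun b => conj (c b) := by
  unfold Zc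
  rw [conj_trace, conjMat_exp, map_add, map_neg, conjMat_smul, conjMat_onSiteSum, conjMat_hopSum]

/-- The one-site partition function at conjugate parameters. [folklore] -/
theorem conj_atomicPartitionFn (β U μ : ℂ) :
    conj (atomicPartitionFn β U μ) = atomicPartitionFn (conj β) (conj U) (conj μ) := by
  unfold atomicPartitionFn
  simp only [map_add, map_mul, map_one, map_neg, map_sub, ← Complex.exp_conj, map_ofNat]

/-- The normalised Gibbs factor at conjugate parameters. [folklore] -/
theorem conj_gibbsRatio (β U μ : ℂ) (c : Bond Λ → ℂ) :
    conj (gibbsRatio β U μ c) = gibbsRatio (conj β) (conj U) (conj μ) fun b => conj (c b) := by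
  unfold gibbsRatio
  rw [map_div₀, conj_Zc, conj_Zc]
  congr 2
  funext b
  simp

omit [Fintype Λ] in
/-- Conjugate couplings. [folklore] -/
theorem conj_couplingOn (τ : ℂ) (K : Finset (Bond Λ)) (b : Bond Λ) : conj (couplingOn τ K b) = couplingOn (conj τ) K b := by
  rw [couplingOn_apply, couplingOn_apply, apply_ite conj, map_zero]

/-- The bond weights at conjugate parameters. [folklore] -/
theorem conj_bondWeight (β U μ τ : ℂ) (K : Finset (Bond Λ)) :
    conj (bondWeight β U μ τ K) = bondWeight (conj β) (conj U) (conj μ) (conj τ) K := by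
  rw [bondWeight_eq_sum, bondWeight_eq_sum, map_sum]
  refine Finset.sum_congr rfl fun K' _ => ?_
  rw [map_mul, map_pow, map_neg, map_one, conj_gibbsRatio]
  congr 2
  funext b
  exact conj_couplingOn τ K' b

/-- The site activity at conjugate parameters. [folklore] -/
theorem conj_siteActivity (G : SimpleGraph Λ) [DecidableRel G.Adj] (β U μ τ : ℂ) (A : Finset Λ) :
    conj (siteActivity G β U μ τ A) = siteActivity G (conj β) (conj U) (conj μ) (conj τ) A := by
  rw [siteActivity_apply, siteActivity_apply, map_sum]
  exact Finset.sum_congr rfl fun X _ => conj_bondWeight β U μ τ X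

end Conj

section ConjLattice

variable {d : ℕ}

/-- **The lattice activity at conjugate parameters.** [folklore] -/
theorem conj_latticeActivity (β U μ τ : ℂ) (A : Finset (Site d)) :
    conj (latticeActivity d β U μ τ A) = latticeActivity d (conj β) (conj U) (conj μ) (conj τ) A :=
  conj_siteActivity _ β U μ τ _

/-- **Reality**: at real parameters the lattice activity is real. [cite: Ueltschi1999, §2.3 (for real β, μ the weights are real traces)] -/
theorem latticeActivity_im_eq_zero (β U μ τ : ℝ) (A : Finset (Site d)) :
    (latticeActivity d (β : ℂ) (U : ℂ) (μ : ℂ) (τ : ℂ) A).im = 0 := by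
  rw [← Complex.conj_eq_iff_im, conj_latticeActivity]
  simp only [Complex.conj_ofReal]

end ConjLattice

/-! ### Holomorphy in `(β, μ)` -/

section Holomorphy

open scoped Matrix.Norms.L2Operator

variable {Λ : Type*} [LinearOrder Λ] [Fintype Λ]

/-- `Σ_{x ∈ A} n_{x↑} n_{x↓}`. [folklore] -/
def nnSum (A : Finset Λ) : Matrix (Finset (Orb Λ)) (Finset (Orb Λ)) ℂ := ∑ x ∈ A, numberOp x 0 * numberOp x 1

/-- `Σ_{x ∈ A} (n_{x↑} + n_{x↓})`. [folklore] -/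
def nSum (A : Finset Λ) : Matrix (Finset (Orb Λ)) (Finset (Orb Λ)) ℂ := ∑ x ∈ A, (numberOp x 0 + numberOp x 1)

/-- `V_A(U, μ) = U Σ n n - μ Σ (n + n)`. [folklore] -/
theorem onSiteSum_eq_smul_sub_smul (U μ : ℂ) (A : Finset Λ) : onSiteSum U μ A = U • nnSum A - μ • nSum A := by
  unfold onSiteSum onSiteOp nnSum nSum
  rw [Finset.smul_sum, Finset.smul_sum, ← Finset.sum_sub_distrib]

/-- `hopSum` is homogeneous. [folklore] -/
theorem hopSum_smul (τ : ℂ) (s : Bond Λ → ℂ) : hopSum (τ • s) = τ • hopSum s := by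
  unfold hopSum
  rw [Finset.smul_sum]
  exact Finset.sum_congr rfl fun b _ => by rw [Pi.smul_apply, smul_eq_mul, smul_smul]

/-- The Gibbs factor at the couplings `τ 1_K` with the exponent written as a polynomial in
`(β, βμ, τ)`. [folklore] -/
theorem Zc_couplingOn_eq (β U μ τ : ℂ) (K : Finset (Bond Λ)) :
    Zc β U μ (couplingOn τ K) =
      (NormedSpace.exp ((-(β * U)) • nnSum (Finset.univ : Finset Λ) + (β * μ) • nSum (Finset.univ : Finset Λ) +
        τ • hopSum (Set.indicator (↑K : Set (Bond Λ)) 1))).trace := by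
  rw [Zc, couplingOn, hopSum_smul, onSiteSum_eq_smul_sub_smul, smul_sub, smul_smul, smul_smul]
  congr 2
  rw [neg_sub, neg_smul]
  abel

/-- The matrix exponential is entire. [folklore] -/
theorem differentiable_matrix_exp :
    Differentiable ℂ fun X : Matrix (Finset (Orb Λ)) (Finset (Orb Λ)) ℂ => NormedSpace.exp X :=
  fun X => (NormedSpace.exp_analytic (𝕂 := ℂ) X).differentiableAt

/-- `(β, μ) ↦ Zc(β, U, μ; βt 1_K)` is entire. [cite: Ueltschi1999, §2.3 (matrix elements analytic in β, μ)] -/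
theorem differentiable_Zc_couplingOn (U t : ℂ) (K : Finset (Bond Λ)) :
    Differentiable ℂ fun z : ℂ × ℂ => Zc (Λ := Λ) z.1 U z.2 (couplingOn (z.1 * t) K) := by
  simp_rw [Zc_couplingOn_eq]
  have htr : Differentiable ℂ (fun X : Matrix (Finset (Orb Λ)) (Finset (Orb Λ)) ℂ => X.trace) :=
    (Matrix.traceLinearMap (Finset (Orb Λ)) ℂ ℂ).toContinuousLinearMap.differentiable
  have hin : Differentiable ℂ (fun z : ℂ × ℂ =>
      (-(z.1 * U)) • nnSum (Finset.univ : Finset Λ) + (z.1 * z.2) • nSum (Finset.univ : Finset Λ) +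
        (z.1 * t) • hopSum (Set.indicator (↑K : Set (Bond Λ)) 1)) := by
    fun_prop
  exact htr.comp (differentiable_matrix_exp.comp hin)

/-- `(β, μ) ↦ z₀(β, U, μ)` is entire. [folklore] -/
theorem differentiable_atomicPartitionFn (U : ℂ) :
    Differentiable ℂ fun z : ℂ × ℂ => atomicPartitionFn z.1 U z.2 := by
  unfold atomicPartitionFn
  fun_prop

/-- `(β, μ) ↦ g(βt 1_K)` is holomorphic where `z₀ ≠ 0`. [cite: Ueltschi1999, §2.3] -/
theorem differentiableOn_gibbsRatio_couplingOn (U t : ℂ) (K : Finset (Bond Λ)) :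
    DifferentiableOn ℂ (fun z : ℂ × ℂ => gibbsRatio (Λ := Λ) z.1 U z.2 (couplingOn (z.1 * t) K))
      {z | atomicPartitionFn z.1 U z.2 ≠ 0} := by
  have h : (fun z : ℂ × ℂ => gibbsRatio (Λ := Λ) z.1 U z.2 (couplingOn (z.1 * t) K)) =
      fun z => Zc (Λ := Λ) z.1 U z.2 (couplingOn (z.1 * t) K) * (atomicPartitionFn z.1 U z.2 ^ Fintype.card Λ)⁻¹ := by
    funext z
    rw [gibbsRatio, Zc_zero, div_eq_mul_inv]
  rw [h]
  refine (differentiable_Zc_couplingOn U t K).differentiableOn.mul ?_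
  refine ((differentiable_atomicPartitionFn U).pow _).differentiableOn.inv fun z hz => ?_
  exact pow_ne_zero _ hz

/-- `(β, μ) ↦ M(K)` is holomorphic where `z₀ ≠ 0`. [cite: Ueltschi1999, §2.3] -/
theorem differentiableOn_bondWeight (U t : ℂ) (K : Finset (Bond Λ)) :
    DifferentiableOn ℂ (fun z : ℂ × ℂ => bondWeight (Λ := Λ) z.1 U z.2 (z.1 * t) K)
      {z | atomicPartitionFn z.1 U z.2 ≠ 0} := by
  simp_rw [bondWeight_eq_sum]
  refine DifferentiableOn.fun_sum fun K' _ => ?_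
  exact (differentiableOn_const _).mul (differentiableOn_gibbsRatio_couplingOn U t K')

/-- `(β, μ) ↦ siteActivity A` is holomorphic where `z₀ ≠ 0`. [cite: Ueltschi1999, §2.3 (Φ^T(C) analytic in β and μ)] -/
theorem differentiableOn_siteActivity (G : SimpleGraph Λ) [DecidableRel G.Adj] (U t : ℂ) (A : Finset Λ) :
    DifferentiableOn ℂ (fun z : ℂ × ℂ => siteActivity G z.1 U z.2 (z.1 * t) A)
      {z | atomicPartitionFn z.1 U z.2 ≠ 0} := by
  simp_rw [siteActivity_apply]
  exact DifferentiableOn.fun_sum fun X _ => differentiableOn_bondWeight U t X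

end Holomorphy

section HolomorphyLattice

variable {d : ℕ}

/-- **Holomorphy of the lattice activity in `(β, μ)`** on `{z₀ ≠ 0}`. [cite: Ueltschi1999, §2.3 (Φ^T(C) analytic in β and μ)] -/
theorem differentiableOn_latticeActivity (U t : ℂ) (A : Finset (Site d)) :
    DifferentiableOn ℂ (fun z : ℂ × ℂ => latticeActivity d z.1 U z.2 (z.1 * t) A)
      {z | atomicPartitionFn z.1 U z.2 ≠ 0} :=
  differentiableOn_siteActivity _ U t _

end HolomorphyLattice

/-! ### The admissible complex domain -/

section Admissible

/-- `(β, μ) ↦ siteRatio β U μ` is continuous where `z₀ ≠ 0`. [folklore] -/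
theorem continuousOn_siteRatio (U : ℂ) :
    ContinuousOn (fun z : ℂ × ℂ => siteRatio z.1 U z.2) {z | atomicPartitionFn z.1 U z.2 ≠ 0} := by
  unfold siteRatio atomicPartitionFnReal
  refine ContinuousOn.div (Continuous.continuousOn (by fun_prop)) ?_ fun z hz => (norm_ne_zero_iff.2 hz)
  exact (continuous_norm.comp (differentiable_atomicPartitionFn U).continuous).continuousOn

/-- **The admissible domain** of complex `(β, μ)` for fixed real `U`, `t`: `z₀(β, U, μ) ≠ 0`,
site ratio `< 2`, and `|β| t < τ₀`. [cite: Ueltschi1999, §3 (domain D₁: βt < ε)] -/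
def admissibleSet (U t : ℝ) : Set (ℂ × ℂ) :=
  {z | atomicPartitionFn z.1 U z.2 ≠ 0 ∧ siteRatio z.1 U z.2 < 2 ∧ ‖z.1‖ * t < tau0}

/-- The admissible domain is open. [folklore] -/
theorem isOpen_admissibleSet (U t : ℝ) : IsOpen (admissibleSet U t) := by
  have hO : IsOpen {z : ℂ × ℂ | atomicPartitionFn z.1 U z.2 ≠ 0} :=
    isOpen_ne_fun (differentiable_atomicPartitionFn (U : ℂ)).continuous continuous_const
  have h1 : IsOpen ({z : ℂ × ℂ | atomicPartitionFn z.1 U z.2 ≠ 0} ∩ (fun z : ℂ × ℂ => siteRatio z.1 U z.2) ⁻¹' Set.Iio 2) :=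
    (continuousOn_siteRatio (U : ℂ)).isOpen_inter_preimage hO isOpen_Iio
  have h2 : IsOpen {z : ℂ × ℂ | ‖z.1‖ * t < tau0} :=
    isOpen_lt (by fun_prop) continuous_const
  have heq : admissibleSet U t =
      ({z : ℂ × ℂ | atomicPartitionFn z.1 U z.2 ≠ 0} ∩ (fun z : ℂ × ℂ => siteRatio z.1 U z.2) ⁻¹' Set.Iio 2) ∩
        {z : ℂ × ℂ | ‖z.1‖ * t < tau0} := by
    ext z
    simp only [admissibleSet, Set.mem_setOf_eq, Set.mem_inter_iff, Set.mem_preimage, Set.mem_Iio, and_assoc]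
  rw [heq]
  exact h1.inter h2

/-- Real points `(β, μ)` with `0 ≤ β`, `βt < τ₀` are admissible. [cite: Ueltschi1999, §3 (D₁ = {βt < ε})] -/
theorem mem_admissibleSet_of_real {U t β : ℝ} (μ : ℝ) (hβ : 0 ≤ β) (hβt : β * t < tau0) :
    ((β : ℂ), (μ : ℂ)) ∈ admissibleSet U t := by
  refine ⟨?_, ?_, ?_⟩
  · show atomicPartitionFn (β : ℂ) (U : ℂ) (μ : ℂ) ≠ 0
    rw [atomicPartitionFn_ofReal]
    exact_mod_cast (atomicPartitionFnReal_pos β U μ).ne'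
  · show siteRatio (β : ℂ) (U : ℂ) (μ : ℂ) < 2
    rw [siteRatio_ofReal]; norm_num
  · show ‖(β : ℂ)‖ * t < tau0
    rwa [Complex.norm_real, Real.norm_eq_abs, abs_of_nonneg hβ]

/-- **On the admissible domain the lattice activity on `ℤ²` is a small translation-invariant
activity** (`δ = 1`), for `t ≥ 0`. [cite: Ueltschi1999, §3 (Theorem 3.1 on D₁ via Proposition 2.2)] -/
theorem isSmallTIActivity_of_mem_admissibleSet {U t : ℝ} (ht : 0 ≤ t) {z : ℂ × ℂ} (hz : z ∈ admissibleSet U t) :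
    IsSmallTIActivity (latticeActivity 2 z.1 U z.2 (z.1 * t)) 1 := by
  obtain ⟨hz0, hr, hτ⟩ := hz
  refine isSmallTIActivity_latticeActivity hz0 hr.le ?_
  rw [norm_mul, Complex.norm_real, Real.norm_eq_abs, abs_of_nonneg ht]
  exact hτ.le

/-- **Analyticity of the polymer pressure of the Hubbard lattice activity in `(β, μ)`** on the
admissible domain (`t ≥ 0`): the several-variable Vitali/Weierstrass argument of
`PolymerPressureAnalytic` applied to the holomorphic family of small activities.
[cite: Ueltschi1999, proof of Theorem 2.1 (i) ("the free energy f(β, μ) is an analytic function by Vitali theorem")] -/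
theorem analyticOnNhd_polymerPressure_lattice {U t : ℝ} (ht : 0 ≤ t) :
    AnalyticOnNhd ℂ (fun z : ℂ × ℂ => polymerPressure (latticeActivity 2 z.1 U z.2 (z.1 * t))) (admissibleSet U t) :=
  analyticOnNhd_polymerPressure (isOpen_admissibleSet U t) (by norm_num)
    (fun A => (differentiableOn_latticeActivity (U : ℂ) (t : ℂ) A).mono fun z hz => hz.1)
    fun z hz => isSmallTIActivity_of_mem_admissibleSet ht hz

end Admissible

end Literature.MathematicalPhysics.QuantumLattice

end
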